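import Summits.BirchSwinnertonDyer.BirchSwinnertonDyer.Theses.TwoAdicConverse
import Summits.BirchSwinnertonDyer.Rank1Residual.Additive.KatoDescentDatum
import Literature.NumberTheory.EllipticCurves.BSDSelmerCMPConverseKatoDescentProofs
import Literature.NumberTheory.EllipticCurves.Kato2004.MainConjectureSkeletonProofs
import HarnessLib

/-!
# Route `TwoAdicConverse`: the rank-`0` `2`-converse (`MultiplicativeRankZeroTwoConverse`, item
# stmt-BirchSwinnertonDyer-19219; `GoodOrdinaryRankZeroTwoConverse`, item 19218) on the
# KATO-ZETA-ELEMENT ROAD of Burungale–Tian (Ann. of Math. 203 (2026), Thm. 3.1 and Remark 3.2):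
# ONE reduction-type-free research object — Kato's Main Conjecture 12.10 in `Λ ⊗ ℚ₂` for `f_E`

WHAT IS PROVED (seat bsd-2adic-conv-2 GEN 2, D-0074 (A) «find: 19219 MultiplicativeRankZeroTwoConverse
likewise; if found ⇒ S3 mult case»; THEOREMS ONLY — no definition, no named fact, nothing asserted).

The source. A. A. Burungale, Y. Tian, *A rank zero `p`-converse to a theorem of Gross–Zagier,
Kolyvagin and Rubin*, Ann. of Math. (2) 203 (2026) 1–13 = arXiv:2506.03465v2 [BurungaleTian2026],
proves the rank-`0` `p`-converse for CM curves at EVERY prime `p` (Thm. 1.1) by a deduction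
(Thm. 3.1, p. 6) whose only non-classical input is Kato's main conjecture in `Λ ⊗ ℚ`
(zeta elements versus `𝐇²`, Astérisque 295 Conj. 12.10 — for `p = 2` Kato states it exactly at the
height-one primes not containing `2`, i.e. in `Λ ⊗ ℚ`), and records (Remark 3.2, p. 6): «This
deduction of the rank zero `p`-converse from Kato's main conjecture holds for any elliptic newform.»
The deduction uses NO `p`-adic `L`-function, NO ordinarity, NO control theorem, NO exceptional-zero /
`𝓛`-invariant analysis and NO period normalisation: Kato Thm. 12.4 (`𝐇¹` torsion-free of rank one,
`𝐇²` torsion), Thm. 12.5 (zeta elements, `𝐇¹/Z` torsion; (1) = the explicit reciprocity law),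
(14.9.3) (`H¹_f(ℚ, V) = 0 ⟹ H²(ℤ[1/p], V) = 0`), the specialisation `𝐇¹_Γ ↪ H¹(ℤ[1/p], T)` and the
vanishing of `H¹(ℚ_ℓ, V_pE)` for `ℓ ≠ p`. The source also places the non-CM case (p. 3): «it is
natural to seek the rank zero 2-converse for non-CM curves. In the near future we plan to consider
instances of Kato's main conjecture for 2-ordinary non-CM curves.»

The tree already holds (a) the `Λ`-module skeleton of that proof, PROVED
(`Literature.…BSDSelmerCMPConverseKatoDescentProofs`: the generator lemma
`IwasawaAlgebra.exists_forall_pow_smul_mkQ_ne_zero_of_span_pow_mul_charIdeal_eq`, and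
`BurungaleTian2026.entireLFunction_one_ne_zero_of_skeleton`), and (b) Kato's §14.14 descent datum as
an INTERFACE structure `Summit.….Rank1Residual.Additive.KatoDescentDatum p` (abstract `Λ`-modules
`H ⊇ Λz`, `H2`, `A` with (14.14.1) `0 → H/TH →ι A →π H2[T] → 0`; its `Conj1210`, `Divisibility`) with
the reading pattern «interface predicate `IsOf` as a variable, printed theorems as hypothesis
schemata over it» (cell `bsd-potss`). THIS FILE composes (a) on (b) and concludes the ROUTE DECLS by
name:

* §1 (pure `Λ`-algebra on a datum, PROVED): `KatoZeta.forall_pow_smul_iota_zeta_ne_zero` — Kato's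
  Conj. 12.10 in `Λ ⊗ ℚ` for the datum (`p^a·char H2 = p^b·char(H/Λz)`) and `H2/TH2` finite ⟹ the
  image `ι(z mod TH)` of the zeta element in `A = H¹(ℤ[1/p], T)` is not `ℤ_p`-torsion
  (`p^m • ι(z̄) ≠ 0` for all `m`); variants from the integral `D.Conj1210` and from the single
  `(T)`-local length equality (the exact amount of 12.10 the converse consumes).
* §2 (per curve, ANY `E/ℚ`, ANY prime `p`, ANY reduction type — Remark 3.2):
  `KatoZeta.entireLFunction_one_ne_zero_of_datum` / `…analyticRank_eq_zero_of_datum`: a datum `D` at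
  `(W, p)` + the two printed readings at THIS datum {(3.1): `Sel_{p^∞}(E/ℚ)` finite ⟹ `H2/TH2` finite
  [Kato (14.9.3) + (14.14.2)]; (VAN): `Sel_{p^∞}(E/ℚ)` finite ∧ `L(E,1) = 0` ⟹ `ι(z̄)` torsion [Kato's
  explicit reciprocity law Thm. 12.5 (1): `L(E,1) = 0` puts `loc_p z` in `H¹_f(ℚ_p, V)`; `H¹(ℚ_ℓ, V_pE)
  = 0` for `ℓ ≠ p`; so `z ∈ H¹_f(ℚ, V_pE) = 0` — the source's (3.3) read contrapositively]} + Conj.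
  12.10 `⊗ ℚ` at `D` ⟹ (`Sel_{p^∞}` finite ⟹ `L(E,1) ≠ 0`) and (`corank Sel_{p^∞} = 0 ⟹ r_an = 0`).
  Modularity is NOT used (`r_an = 0` from `L(E,1) ≠ 0` is definitional, tree theorem
  `analyticRank_eq_zero_of_entireLFunction_one_ne_zero`).
* §3 (the ∀-closed BRIDGES at `p = 2`, interface predicate `IsOf` a variable as in
  `KatoDescentDatum.lean` §2): from the three PRINT readings {(R) a datum exists at `(W, 2)` — Kato
  12.4, 12.5, §14.14, over the cyclotomic `ℤ₂`-extension `ℚ_∞/ℚ`; (3.1); (VAN)} and the ONE research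
  object `hMC : ∀ non-CM W (of the branch), ∀ realised D, Conj. 12.10 ⊗ ℚ₂ at D`:
  `multiplicativeRankZeroTwoConverse_of_katoMainConjectureRat : … → MultiplicativeRankZeroTwoConverse`
  (item 19219), `goodOrdinaryRankZeroTwoConverse_of_katoMainConjectureRat : … →
  GoodOrdinaryRankZeroTwoConverse` (item 19218), and the REDUCTION-TYPE-FREE statement
  `nonCM_rankZero_twoConverse_of_katoMainConjectureRat` (every non-CM `E/ℚ`: good ordinary,
  multiplicative, supersingular AND additive at `2` alike) — the same object, the same three readings.

CONSEQUENCE FOR THE PLANNER (the «likewise» answered a second way). On the cyclotomic `p`-adic-`L`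
road (GEN 0: `Theorems/TwoAdicConverseMultEisenstein.lean`, `…MultLambdaRoad.lean`) 19219 hinges on the
multiplicative Eisenstein object (T-mult-4 / λ-part) and needs A235/A236, Greenberg–Stevens at `2`,
Mahler–Manin, the rational period `ϖ` and K11. On the zeta road of this file 19218 AND 19219 (and the
supersingular / additive members of the leaf's complement) hinge on ONE reduction-type-free object,
Kato's Main Conjecture 12.10 in `Λ ⊗ ℚ₂` for the non-CM newform `f_E` — a NAMED conjecture with a
PRINTED reduction (B–T Thm. 3.1 + Rmk. 3.2) — and on three printed Kato readings valid at every prime.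
Status of the object: OPEN for non-CM `f` at `p = 2` (B–T p. 3 quoted above; for `p` odd good ordinary
it is Kato 17.4 + Skinner–Urban via §17.13, tree skeleton `Kato2004.conj12_10_iff_conj17_6_of_skeleton`);
Kato's Thm. 12.5 (3)/(4) gives the inequality `length H2_𝔮 ≤ length (H/Z)_𝔮`, so the open content is
the single reverse inequality (the Eisenstein / lower-bound direction), of which the converse consumes
only the prime `𝔮 = (T)` (§1, `…_of_lengthAt_primeT_eq`). Nothing here is credited as progress on
BSD; a closed item would close a rung leaf («closes rung S3 of BirchSwinnertonDyer»), never the summit.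
PARTITION: none — RANK axis (S3, both rank-0 cruxes); companion formula cell X5@2 (B1·O1).
-/

set_option autoImplicit false
set_option linter.dupNamespace false

noncomputable section

open scoped Classical

open WeierstrassCurve Literature.NumberTheory.EllipticCurves
  Literature.NumberTheory.EllipticCurves.Rank1Residual
  Summit.BirchSwinnertonDyer.Rank1Residual.Additive

namespace Summit.BirchSwinnertonDyer.BirchSwinnertonDyer.Theorems

namespace KatoZeta

/-! ## §1 The `Λ`-module step of Burungale–Tian Thm. 3.1 on a Kato descent datum (PROVED) -/

section Skeleton

variable {p : ℕ} [Fact p.Prime] (D : KatoDescentDatum p)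

/-- **Burungale–Tian's `Λ`-module step on a Kato descent datum.** For a datum `D` (Kato's `𝐇¹ = H`
torsion-free with the zeta line `Λz`, `H/Λz` torsion; `𝐇² = H2` torsion; (14.14.1)
`0 → H/TH →ι A →π H2[T] → 0`, `A = H¹(ℤ[1/p], T)`): if Kato's Main Conjecture 12.10 holds for `D` in
`Λ ⊗ ℚ` (`p^a · char_Λ H2 = p^b · char_Λ (H/Λz)`, an equality of ideals of `Λ` with `p`-power
denominators cleared) and `H2/TH2` (`= H²(ℤ[1/p], T)` by (14.14.2)) is finite, then the image
`ι(z mod TH)` of the zeta element in `A` is not `ℤ_p`-torsion: `p^m • ι(z̄) ≠ 0` for every `m`. This is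
«Hence Theorem 2.6 implies that `z` is [non-zero in] `H¹(ℤ[1/p], T(k/2)) ⊗ ℚ`» of the printed proof,
through the tree's generator lemma (`G = {z}`) and the injectivity of `ι`.
[cite: BurungaleTian2026, Thm. 3.1 (proof, p. 6: (3.1)–(3.2) and the sentence after (3.2)) and Remark 3.2]
[cite: Kato2004Asterisque, Conj. 12.10 (p. 224) and §14.14 (14.14.1) (p. 243)] -/
theorem forall_pow_smul_iota_zeta_ne_zero
    (hMC : ∃ a b : ℕ,
      Ideal.span {(p : IwasawaAlgebra p) ^ a} * Module.charIdeal (IwasawaAlgebra p) D.H2 =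
        Ideal.span {(p : IwasawaAlgebra p) ^ b} *
          Module.charIdeal (IwasawaAlgebra p) (D.H ⧸ (IwasawaAlgebra p) ∙ D.z))
    (hfin : Finite (IwasawaAlgebra.coinvariants p D.H2)) :
    ∀ m : ℕ, p ^ m • D.ι (Submodule.Quotient.mk D.z) ≠ 0 := by
  have hG : ∃ g ∈ ({D.z} : Set D.H), g ≠ 0 := ⟨D.z, Set.mem_singleton _, D.z_ne_zero⟩
  obtain ⟨g, hg, h⟩ :=
    IwasawaAlgebra.exists_forall_pow_smul_mkQ_ne_zero_of_span_pow_mul_charIdeal_eq p hG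
      D.isTorsion_quotient D.isTorsion_H2 hMC hfin
  rw [Set.mem_singleton_iff] at hg
  subst hg
  intro m hm
  refine h m (D.ι_injective ?_)
  rw [map_nsmul, hm, map_zero]

/-- **The same from the INTEGRAL Conjecture 12.10 on the datum** (`D.Conj1210`: equal local lengths
of `H2` and `H/Λz` at EVERY height-one prime, the shape used at odd `p` by the interface lemma
`ReadsTrivialKMC`): equal height-one lengths give equal characteristic ideals
(`Module.charIdeal_eq_of_lengthAt_eq`), i.e. the `Λ ⊗ ℚ` form with `a = b = 0`. (At `p = 2` Kato
states 12.10 only at the primes not containing `2`; the `Λ ⊗ ℚ` form above is that statement.)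
[cite: Kato2004Asterisque, Conj. 12.10 (p. 224)] [cite: BurungaleTian2026, Thm. 3.1 (proof, p. 6)] -/
theorem forall_pow_smul_iota_zeta_ne_zero_of_conj1210 (hMC : D.Conj1210)
    (hfin : Finite (IwasawaAlgebra.coinvariants p D.H2)) :
    ∀ m : ℕ, p ^ m • D.ι (Submodule.Quotient.mk D.z) ≠ 0 := by
  refine forall_pow_smul_iota_zeta_ne_zero D ⟨0, 0, ?_⟩ hfin
  rw [Module.charIdeal_eq_of_lengthAt_eq hMC]

/-- **The exact amount of Conjecture 12.10 the converse consumes: the prime `𝔮 = (T)` alone.** If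
`length_{(T)} (H/Λz) = length_{(T)} H2` and `H2/TH2` is finite (so `length_{(T)} H2 = 0`, Kato's
Lemma 14.15 / Greenberg's Lemma 4.2, tree theorem
`Kato2004.lengthAt_primeT_eq_zero_of_finite_coinvariants`), then `(H/Λz)_{(T)} = 0` and the generator
lemma applies verbatim. (As a hypothesis about a curve this `(T)`-local equality is — given the
readings of §2 — equivalent to the converse itself; the research object displayed in §3 is therefore
Kato's conjecture in `Λ ⊗ ℚ`, not this local shadow.)
[cite: Kato2004Asterisque, Conj. 12.10 (p. 224) and Lemma 14.15 (p. 244)]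
[cite: BurungaleTian2026, Thm. 3.1 (proof, p. 6)] -/
theorem forall_pow_smul_iota_zeta_ne_zero_of_lengthAt_primeT_eq
    (hT : Module.lengthAt (IwasawaAlgebra p) (D.H ⧸ (IwasawaAlgebra p) ∙ D.z)
        (IwasawaAlgebra.primeT p) =
      Module.lengthAt (IwasawaAlgebra p) D.H2 (IwasawaAlgebra.primeT p))
    (hfin : Finite (IwasawaAlgebra.coinvariants p D.H2)) :
    ∀ m : ℕ, p ^ m • D.ι (Submodule.Quotient.mk D.z) ≠ 0 := by
  have h0 : Module.lengthAt (IwasawaAlgebra p) (D.H ⧸ (IwasawaAlgebra p) ∙ D.z)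
      (IwasawaAlgebra.primeT p) = 0 := by
    rw [hT]
    exact Kato2004.lengthAt_primeT_eq_zero_of_finite_coinvariants D.H2 D.isTorsion_H2 hfin
  have hG : ∃ g ∈ ({D.z} : Set D.H), g ≠ 0 := ⟨D.z, Set.mem_singleton _, D.z_ne_zero⟩
  obtain ⟨g, hg, h⟩ :=
    IwasawaAlgebra.exists_forall_pow_smul_notMem_TSubmodule_of_lengthAt_eq_zero p hG h0
  rw [Set.mem_singleton_iff] at hg
  subst hg
  intro m hm
  refine h m ?_
  -- `p^m • z ∈ TH`, since `ι` is injective and `p^m • ι(z̄) = 0`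
  have hmk : (Submodule.Quotient.mk (p ^ m • D.z) : IwasawaAlgebra.coinvariants p D.H) = 0 := by
    have h1 : (Submodule.Quotient.mk (p ^ m • D.z) : IwasawaAlgebra.coinvariants p D.H) =
        p ^ m • Submodule.Quotient.mk D.z :=
      map_nsmul (IwasawaAlgebra.TSubmodule p D.H).mkQ (p ^ m) D.z
    apply D.ι_injective
    rw [h1, map_nsmul, hm, map_zero]
  rw [Submodule.Quotient.mk_eq_zero] at hmk
  rw [← Nat.cast_pow, Nat.cast_smul_eq_nsmul]
  exact hmk

end Skeleton

/-! ## §2 The rank-`0` `p`-converse for ANY `E/ℚ` at ANY prime from a datum and two readings -/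

section PerCurve

variable (W : WeierstrassCurve ℚ) [W.IsElliptic] (p : ℕ) [Fact p.Prime] (D : KatoDescentDatum p)

omit [W.IsElliptic] in
/-- **Burungale–Tian Thm. 3.1 / Remark 3.2 for `f = f_E`, ANY `E/ℚ`, ANY prime `p`, ANY reduction
type at `p`, on a Kato descent datum `D` at `(E, p)`.** Displayed inputs at THIS datum: (3.1)
`h31` — `Sel_{p^∞}(E/ℚ)` finite ⟹ `H2/TH2 = H²(ℤ[1/p], T)` finite [Kato (14.9.3): `H¹_f(ℚ, V_pE) = 0 ⟹
H²(ℤ[1/p], V) = 0`, with (14.14.2); PRINT]; (VAN) `hvan` — `Sel_{p^∞}(E/ℚ)` finite and `L(E,1) = 0`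
⟹ `ι(z̄)` is torsion in `A = H¹(ℤ[1/p], T)` [Kato's explicit reciprocity law Thm. 12.5 (1): the dual
exponential of `loc_p z_γ` is a period of `γ` times `L_{(p)}(E,1)`, so `L(E,1) = 0` puts `loc_p z` in
`H¹_f(ℚ_p, V)`; `H¹(ℚ_ℓ, V_pE) = 0` for `ℓ ≠ p`; hence `z ∈ H¹_f(ℚ, V_pE)`, which vanishes when
`Sel_{p^∞}(E/ℚ)` is finite — the source's (3.3) and last sentence, read contrapositively; PRINT];
(MC) `hMC` — Kato's Main Conjecture 12.10 in `Λ ⊗ ℚ` at `D` [OPEN in general; B–T Thm. 2.6 for CM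
`f`]. Conclusion: `Sel_{p^∞}(E/ℚ)` finite ⟹ `L(E,1) ≠ 0`. Proof = §1.
[cite: BurungaleTian2026, Thm. 3.1 (proof, p. 6) and Remark 3.2]
[cite: Kato2004Asterisque, Thm. 12.5 (1) (p. 222), (14.9.3) (p. 241), §14.14 (p. 243)] -/
theorem entireLFunction_one_ne_zero_of_datum
    (h31 : Finite (W.selmerGroupPInfty p) → Finite (IwasawaAlgebra.coinvariants p D.H2))
    (hvan : Finite (W.selmerGroupPInfty p) → W.entireLFunction 1 = 0 →
      ∃ n : ℕ, p ^ n • D.ι (Submodule.Quotient.mk D.z) = 0)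
    (hMC : ∃ a b : ℕ,
      Ideal.span {(p : IwasawaAlgebra p) ^ a} * Module.charIdeal (IwasawaAlgebra p) D.H2 =
        Ideal.span {(p : IwasawaAlgebra p) ^ b} *
          Module.charIdeal (IwasawaAlgebra p) (D.H ⧸ (IwasawaAlgebra p) ∙ D.z))
    (hfin : Finite (W.selmerGroupPInfty p)) :
    W.entireLFunction 1 ≠ 0 := by
  intro hL
  obtain ⟨n, hn⟩ := hvan hfin hL
  exact forall_pow_smul_iota_zeta_ne_zero D hMC (h31 hfin) n hn

/-- **The rank-`0` `p`-converse at `(E, p)` on a datum**: `corank_{ℤ_p} Sel_{p^∞}(E/ℚ) = 0 ⟹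
ord_{s=1} L(E,s) = 0`, from the same three displayed inputs (3.1), (VAN), (MC) — any `E/ℚ`, any `p`,
any reduction type. The corank is the tree's `W.selmerCorank p` (`= 0` iff `Sel_{p^∞}` finite,
`finite_selmerGroupPInfty_iff_selmerCorank_eq_zero`); `r_an = 0` from `L(E,1) ≠ 0` needs no
continuation (`analyticRank_eq_zero_of_entireLFunction_one_ne_zero`).
[cite: BurungaleTian2026, Thm. 1.1, Thm. 3.1 and Remark 3.2] -/
theorem analyticRank_eq_zero_of_datum
    (h31 : Finite (W.selmerGroupPInfty p) → Finite (IwasawaAlgebra.coinvariants p D.H2))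
    (hvan : Finite (W.selmerGroupPInfty p) → W.entireLFunction 1 = 0 →
      ∃ n : ℕ, p ^ n • D.ι (Submodule.Quotient.mk D.z) = 0)
    (hMC : ∃ a b : ℕ,
      Ideal.span {(p : IwasawaAlgebra p) ^ a} * Module.charIdeal (IwasawaAlgebra p) D.H2 =
        Ideal.span {(p : IwasawaAlgebra p) ^ b} *
          Module.charIdeal (IwasawaAlgebra p) (D.H ⧸ (IwasawaAlgebra p) ∙ D.z))
    (h0 : W.selmerCorank p = 0) :
    W.analyticRank = 0 :=
  analyticRank_eq_zero_of_entireLFunction_one_ne_zero W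
    (entireLFunction_one_ne_zero_of_datum W p D h31 hvan hMC
      ((finite_selmerGroupPInfty_iff_selmerCorank_eq_zero W p).2 h0))

/-- **Contrapositive (the shape feeding Goldfeld-type statements, B–T §1.0.3):** on a datum with
(3.1), (VAN), (MC), `L(E,1) = 0 ⟹ corank_{ℤ_p} Sel_{p^∞}(E/ℚ) ≥ 1`.
[cite: BurungaleTian2026, Thm. 1.1 and §1.0.3] -/
theorem one_le_selmerCorank_of_entireLFunction_one_eq_zero_of_datum
    (h31 : Finite (W.selmerGroupPInfty p) → Finite (IwasawaAlgebra.coinvariants p D.H2))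
    (hvan : Finite (W.selmerGroupPInfty p) → W.entireLFunction 1 = 0 →
      ∃ n : ℕ, p ^ n • D.ι (Submodule.Quotient.mk D.z) = 0)
    (hMC : ∃ a b : ℕ,
      Ideal.span {(p : IwasawaAlgebra p) ^ a} * Module.charIdeal (IwasawaAlgebra p) D.H2 =
        Ideal.span {(p : IwasawaAlgebra p) ^ b} *
          Module.charIdeal (IwasawaAlgebra p) (D.H ⧸ (IwasawaAlgebra p) ∙ D.z))
    (hL : W.entireLFunction 1 = 0) :
    1 ≤ W.selmerCorank p := by
  by_contra h
  have h0 : W.selmerCorank p = 0 := by omega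
  exact entireLFunction_one_ne_zero_of_datum W p D h31 hvan hMC
    ((finite_selmerGroupPInfty_iff_selmerCorank_eq_zero W p).2 h0) hL

end PerCurve

end KatoZeta

/-! ## §3 The ∀-closed bridges at `p = 2`: ONE object for both rank-`0` cruxes of route S3 -/

section Route

variable {IsOf : ∀ (W : WeierstrassCurve ℚ) [W.IsElliptic] [W.IsGloballyMinimal] (p : ℕ)
  [Fact p.Prime], KatoDescentDatum p → Prop}

/-- **REDUCTION-TYPE-FREE rank-`0` `2`-converse for non-CM `E/ℚ` on the Kato–zeta road.** Interface
predicate `IsOf W p D` («`D` is Kato's §14.14 descent datum of `T₂E` over the cyclotomic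
`ℤ₂`-extension `ℚ_∞/ℚ`: `H = lim_n H¹(ℤ_n[1/2], T₂E)` torsion-free of rank one, `z` a non-zero
`ℤ₂`-multiple of the image of a Beilinson–Kato element `z_γ(f_E)`, `H2 = lim_n H²(ℤ_n[1/2], T₂E)`,
`A = H¹(ℤ[1/2], T₂E)` with (14.14.1)»; a variable, as in `KatoDescentDatum.lean` §2). Displayed PRINT
readings, each a theorem of Kato's valid at every prime, read at `p = 2`: (R) `hR` — a datum exists
[Thm. 12.4 (1)(2), Thm. 12.5 (2), §14.14]; (3.1) `h31` [(14.9.3) + (14.14.2)]; (VAN) `hvan` [Thm. 12.5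
(1) + `H¹(ℚ_ℓ, V₂E) = 0` (`ℓ ≠ 2`) + `H¹_f(ℚ, V₂E) = 0` when `Sel_{2^∞}` is finite]. ONE research
object `hMC`: Kato's Main Conjecture 12.10 in `Λ ⊗ ℚ₂` for the newform of every non-CM `E/ℚ`, read
on its realised data [OPEN; Burungale–Tian p. 3: «we plan to consider instances of Kato's main
conjecture for 2-ordinary non-CM curves»]. Conclusion: for EVERY non-CM `E/ℚ` (globally minimal `W`),
whatever its reduction at `2`, `corank_{ℤ₂} Sel_{2^∞}(E/ℚ) = 0 ⟹ ord_{s=1} L(E,s) = 0`.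
[cite: BurungaleTian2026, Thm. 3.1, Remark 3.2 and §1.0.3 (p. 3)]
[cite: Kato2004Asterisque, Thm. 12.4, Thm. 12.5, Conj. 12.10, (14.9.3), §14.14] -/
theorem nonCM_rankZero_twoConverse_of_katoMainConjectureRat
    (hR : ∀ (W : WeierstrassCurve ℚ) [W.IsElliptic] [W.IsGloballyMinimal],
      ¬ W.HasCM → ∃ D : KatoDescentDatum 2, IsOf W 2 D)
    (h31 : ∀ (W : WeierstrassCurve ℚ) [W.IsElliptic] [W.IsGloballyMinimal] (D : KatoDescentDatum 2),
      IsOf W 2 D → Finite (W.selmerGroupPInfty 2) → Finite (IwasawaAlgebra.coinvariants 2 D.H2))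
    (hvan : ∀ (W : WeierstrassCurve ℚ) [W.IsElliptic] [W.IsGloballyMinimal] (D : KatoDescentDatum 2),
      IsOf W 2 D → Finite (W.selmerGroupPInfty 2) → W.entireLFunction 1 = 0 →
        ∃ n : ℕ, 2 ^ n • D.ι (Submodule.Quotient.mk D.z) = 0)
    (hMC : ∀ (W : WeierstrassCurve ℚ) [W.IsElliptic] [W.IsGloballyMinimal] (D : KatoDescentDatum 2),
      ¬ W.HasCM → IsOf W 2 D → ∃ a b : ℕ,
        Ideal.span {((2 : ℕ) : IwasawaAlgebra 2) ^ a} * Module.charIdeal (IwasawaAlgebra 2) D.H2 =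
          Ideal.span {((2 : ℕ) : IwasawaAlgebra 2) ^ b} *
            Module.charIdeal (IwasawaAlgebra 2) (D.H ⧸ (IwasawaAlgebra 2) ∙ D.z)) :
    ∀ (W : WeierstrassCurve ℚ) [W.IsElliptic] [W.IsGloballyMinimal],
      ¬ W.HasCM → W.selmerCorank 2 = 0 → W.analyticRank = 0 := by
  intro W _ _ hcm h0
  obtain ⟨D, hD⟩ := hR W hcm
  exact KatoZeta.analyticRank_eq_zero_of_datum W 2 D (h31 W D hD) (hvan W D hD) (hMC W D hcm hD) h0

/-- **Bridge to the crux `MultiplicativeRankZeroTwoConverse` (item stmt-BirchSwinnertonDyer-19219) on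
the Kato–zeta road.** PRINT readings (R), (3.1), (VAN) at `p = 2` as in
`nonCM_rankZero_twoConverse_of_katoMainConjectureRat` + the ONE research object, here needed only on
the multiplicative branch: `hMC : ∀ non-CM W multiplicative at 2, ∀ realised D, Kato's Conj. 12.10 in
Λ ⊗ ℚ₂ at D` ⟹ `MultiplicativeRankZeroTwoConverse` (FULLY-QUALIFIED route decl). No `p`-adic
`L`-function, no A235/A236, no Greenberg–Stevens, no `𝓛`-invariant, no period, no K11, no split /
non-split distinction — compare the cyclotomic road `multiplicativeRankZeroTwoConverse_of_multEisenstein`.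
The multiplicative «likewise» of the director's row, second form: 19219 and 19218 hinge on the SAME
reduction-type-free ∀-object. Nothing asserted; closes nothing by itself.
[cite: BurungaleTian2026, Thm. 3.1 and Remark 3.2] [cite: Kato2004Asterisque, Conj. 12.10 (p. 224)] -/
theorem multiplicativeRankZeroTwoConverse_of_katoMainConjectureRat
    (hR : ∀ (W : WeierstrassCurve ℚ) [W.IsElliptic] [W.IsGloballyMinimal],
      ¬ W.HasCM → ∃ D : KatoDescentDatum 2, IsOf W 2 D)
    (h31 : ∀ (W : WeierstrassCurve ℚ) [W.IsElliptic] [W.IsGloballyMinimal] (D : KatoDescentDatum 2),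
      IsOf W 2 D → Finite (W.selmerGroupPInfty 2) → Finite (IwasawaAlgebra.coinvariants 2 D.H2))
    (hvan : ∀ (W : WeierstrassCurve ℚ) [W.IsElliptic] [W.IsGloballyMinimal] (D : KatoDescentDatum 2),
      IsOf W 2 D → Finite (W.selmerGroupPInfty 2) → W.entireLFunction 1 = 0 →
        ∃ n : ℕ, 2 ^ n • D.ι (Submodule.Quotient.mk D.z) = 0)
    (hMC : ∀ (W : WeierstrassCurve ℚ) [W.IsElliptic] [W.IsGloballyMinimal] (D : KatoDescentDatum 2),
      ¬ W.HasCM → Mult W 2 → IsOf W 2 D → ∃ a b : ℕ,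
        Ideal.span {((2 : ℕ) : IwasawaAlgebra 2) ^ a} * Module.charIdeal (IwasawaAlgebra 2) D.H2 =
          Ideal.span {((2 : ℕ) : IwasawaAlgebra 2) ^ b} *
            Module.charIdeal (IwasawaAlgebra 2) (D.H ⧸ (IwasawaAlgebra 2) ∙ D.z)) :
    Summit.BirchSwinnertonDyer.BirchSwinnertonDyer.Theses.TwoAdicConverse.MultiplicativeRankZeroTwoConverse := by
  unfold Summit.BirchSwinnertonDyer.BirchSwinnertonDyer.Theses.TwoAdicConverse.MultiplicativeRankZeroTwoConverse
  intro W _ _ hcm hmult h0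
  obtain ⟨D, hD⟩ := hR W hcm
  exact KatoZeta.analyticRank_eq_zero_of_datum W 2 D (h31 W D hD) (hvan W D hD)
    (hMC W D hcm hmult hD) h0

/-- **Bridge to the crux `GoodOrdinaryRankZeroTwoConverse` (item stmt-BirchSwinnertonDyer-19218) on the
Kato–zeta road** — the good-ordinary twin, same three PRINT readings, research object restricted to
the good-ordinary branch. The rational `2`-torsion point of every good-ordinary non-CM curve at `2`
(the route's «why it might fail» for 19218: `E[2]` reducible, every `𝔽₂^×`-character trivial) plays
no role on this road: Conj. 12.10 in `Λ ⊗ ℚ` and the deduction are insensitive to `E[2]`.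
[cite: BurungaleTian2026, Thm. 3.1 and Remark 3.2] [cite: Kato2004Asterisque, Conj. 12.10 (p. 224)] -/
theorem goodOrdinaryRankZeroTwoConverse_of_katoMainConjectureRat
    (hR : ∀ (W : WeierstrassCurve ℚ) [W.IsElliptic] [W.IsGloballyMinimal],
      ¬ W.HasCM → ∃ D : KatoDescentDatum 2, IsOf W 2 D)
    (h31 : ∀ (W : WeierstrassCurve ℚ) [W.IsElliptic] [W.IsGloballyMinimal] (D : KatoDescentDatum 2),
      IsOf W 2 D → Finite (W.selmerGroupPInfty 2) → Finite (IwasawaAlgebra.coinvariants 2 D.H2))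
    (hvan : ∀ (W : WeierstrassCurve ℚ) [W.IsElliptic] [W.IsGloballyMinimal] (D : KatoDescentDatum 2),
      IsOf W 2 D → Finite (W.selmerGroupPInfty 2) → W.entireLFunction 1 = 0 →
        ∃ n : ℕ, 2 ^ n • D.ι (Submodule.Quotient.mk D.z) = 0)
    (hMC : ∀ (W : WeierstrassCurve ℚ) [W.IsElliptic] [W.IsGloballyMinimal] (D : KatoDescentDatum 2),
      ¬ W.HasCM → GoodOrd W 2 → IsOf W 2 D → ∃ a b : ℕ,
        Ideal.span {((2 : ℕ) : IwasawaAlgebra 2) ^ a} * Module.charIdeal (IwasawaAlgebra 2) D.H2 =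
          Ideal.span {((2 : ℕ) : IwasawaAlgebra 2) ^ b} *
            Module.charIdeal (IwasawaAlgebra 2) (D.H ⧸ (IwasawaAlgebra 2) ∙ D.z)) :
    Summit.BirchSwinnertonDyer.BirchSwinnertonDyer.Theses.TwoAdicConverse.GoodOrdinaryRankZeroTwoConverse := by
  unfold Summit.BirchSwinnertonDyer.BirchSwinnertonDyer.Theses.TwoAdicConverse.GoodOrdinaryRankZeroTwoConverse
  intro W _ _ hcm hord h0
  obtain ⟨D, hD⟩ := hR W hcm
  exact KatoZeta.analyticRank_eq_zero_of_datum W 2 D (h31 W D hD) (hvan W D hD)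
    (hMC W D hcm hord hD) h0

/-- **Both rank-`0` cruxes of route S3 at once** from the readings and the research object on the
leaf's own scope (non-CM, good ordinary OR multiplicative at `2`): the conjunction
`GoodOrdinaryRankZeroTwoConverse ∧ MultiplicativeRankZeroTwoConverse`, i.e. the whole `r = 0` layer of
`NonCMTwoConverse` below the declared residual `RankOneTwoConverse`.
[cite: BurungaleTian2026, Thm. 3.1 and Remark 3.2] -/
theorem rankZero_twoConverse_cruxes_of_katoMainConjectureRat
    (hR : ∀ (W : WeierstrassCurve ℚ) [W.IsElliptic] [W.IsGloballyMinimal],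
      ¬ W.HasCM → ∃ D : KatoDescentDatum 2, IsOf W 2 D)
    (h31 : ∀ (W : WeierstrassCurve ℚ) [W.IsElliptic] [W.IsGloballyMinimal] (D : KatoDescentDatum 2),
      IsOf W 2 D → Finite (W.selmerGroupPInfty 2) → Finite (IwasawaAlgebra.coinvariants 2 D.H2))
    (hvan : ∀ (W : WeierstrassCurve ℚ) [W.IsElliptic] [W.IsGloballyMinimal] (D : KatoDescentDatum 2),
      IsOf W 2 D → Finite (W.selmerGroupPInfty 2) → W.entireLFunction 1 = 0 →
        ∃ n : ℕ, 2 ^ n • D.ι (Submodule.Quotient.mk D.z) = 0)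
    (hMC : ∀ (W : WeierstrassCurve ℚ) [W.IsElliptic] [W.IsGloballyMinimal] (D : KatoDescentDatum 2),
      ¬ W.HasCM → (GoodOrd W 2 ∨ Mult W 2) → IsOf W 2 D → ∃ a b : ℕ,
        Ideal.span {((2 : ℕ) : IwasawaAlgebra 2) ^ a} * Module.charIdeal (IwasawaAlgebra 2) D.H2 =
          Ideal.span {((2 : ℕ) : IwasawaAlgebra 2) ^ b} *
            Module.charIdeal (IwasawaAlgebra 2) (D.H ⧸ (IwasawaAlgebra 2) ∙ D.z)) :
    Summit.BirchSwinnertonDyer.BirchSwinnertonDyer.Theses.TwoAdicConverse.GoodOrdinaryRankZeroTwoConverse ∧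
      Summit.BirchSwinnertonDyer.BirchSwinnertonDyer.Theses.TwoAdicConverse.MultiplicativeRankZeroTwoConverse :=
  ⟨goodOrdinaryRankZeroTwoConverse_of_katoMainConjectureRat hR h31 hvan
      (fun W _ _ D hcm hord hD => hMC W D hcm (Or.inl hord) hD),
    multiplicativeRankZeroTwoConverse_of_katoMainConjectureRat hR h31 hvan
      (fun W _ _ D hcm hmult hD => hMC W D hcm (Or.inr hmult) hD)⟩

end Route

end Summit.BirchSwinnertonDyer.BirchSwinnertonDyer.Theorems

end
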